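import Literature.MathematicalPhysics.QuantumFieldTheory.Balaban1983to89.B8TowerBondsLayerLawSubC

/-!
# `Balaban1983to89.B8IdxB8SubCLayerLawVacuity` — [Balaban1985RegularSpaces] (1.3)–(1.6) p. 77: THE P-CLASS LAW `LevelSepPP` (AND THE (1.5)-READING) IS
# NOT A LAW OF THE ADMISSIBLE SUB-INDEX OF RECORD `Node00.IdxB8SubC θ` — a lawful, admissible, `Ω₀ = ℤᵈ` member of depth `2` with two EXTRA level-`0` tops inside `□₂`
# violates both (census exhibit; the negative companion of `B8TowerBondsLayerLawOfLam` ∕ `B8TowerBondsLayerLawSubC`)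

statement-level skeleton of published theorems with citation tags; proofs where landed; nothing here is a claim about the Yang–Mills mass gap

T. Bałaban, *Spaces of regular gauge field configurations on a lattice and gauge fixing conditions*, Commun. Math. Phys. **99** (1985) 75–102
`[Balaban1985RegularSpaces]` ("B8"; journal page = PDF page + 74): (1.3)–(1.6) p. 77 («Ω₀ ⊃ Ω₁ ⊃ … ⊃ Ω_k», «Ω_j = Bʲ(Ω_j^{(j)})», «Λ_j = Ω_j^{(j)} ∖ Ω_{j+1}^{(j)}»,
«Ω_j^{(j)} = ⋃ B^{l−j}(Λ_l)»), (1.19) p. 79 ∕ (1.34) p. 82 (truncated towers), (1.31) p. 82 (inner bonds «⟨x, x′⟩ ⊂ Λ_j»), (1.131) p. 99, p. 98.  T. Bałaban,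
*Propagators and renormalization transformations for lattice gauge theories. II*, Commun. Math. Phys. **96** (1984) 223–250 `[Balaban1984PropagatorsII]` ("B6"),
(2.1)–(2.3) p. 224.  T. Bałaban, *Propagators for lattice gauge theories in a background field*, Commun. Math. Phys. **99** (1985) 389–434
`[Balaban1985BackgroundPropagators]` ([4]), (3.16) p. 393.

## WHY THIS FILE (cell `pub-ymgap`, HUMAN RULING D-0062 ∕ D-0149; DAG node N05 = [B8] (edge N06 → N05); width seat `pub-ymgap-dag-n05-w2` g3; proof lane, count-neutral)

`B8TowerBondsLayerLawOfLam` (dag-n05-w6 g2) and `B8TowerBondsLayerLawSubC` (this seat) discharge BOTH index laws of the averaging-binder class law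
`LevelSepPP L m Ω (fun m' j => towerBondsP L Ω (Λs m') j) 1` (the `hlaw` of dag-n06-b's `avgAtP_withQQP` ∕ `avgAtγ_withQQP` at PRINT'S class (1.31)) on members of
the «P₂C» records' index `IdxB8SubC θ = {j : IdxB8SubB θ ∕∕ DomainSeq θ.L j.Ω}` — from ONE displayed clause: «the member's top restriction family READS print's (1.5)».
Both files leave open whether that clause is itself a consequence of the index's typed laws (n05-a's `ZdIdx` laws `hbox ∕ hclass ∕ htower ∕ hpart`, NODE 00's located
laws №7 `scale` ∕ №8 `trunc_lt, trunc_top` ∕ №11 `cover` ∕ №12 `bonds`, the (1.3)–(1.4) record `DomainSeq`, `Ω₀ = ℤᵈ`).  THIS FILE answers NO, with a kernel witness at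
EVERY `θ`: adjoin to print's tower `(ℤᵈ, □₁, □₂)` (this seat's fully pinned `exists_topCube_member_pinned`, depth `k = 2`) two EXTRA level-`0` tops `z₀ = 0` and
`z₀ + e_μ` — sites deep inside `□₂` — at every truncation `m ≥ 1`, and let the bond classes be the tower's (`towerBonds`, №12 by `rfl`).  Every typed law tolerates extra
tops: `htower` (their `0`-blocks are points of `Ω₀ = ℤᵈ`), `hpart` ∕ `cover` (more tops), `trunc_lt` (the same tops at every `m ≥ 1`), `trunc_top` (level `0` of
truncation `0` is all of `ℤᵈ` already), `hbox ∕ hclass ∕ bonds` (by construction), `DomainSeq` (reads `Ω` only).  But the inner level-`0` bond `⟨0, e_μ⟩` is a bond of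
print's class (1.31) whose box site `0` lies in `Ω₂`, so a unit bond there touches `Ω₂` with `2 > 0 + 1` — clause 2 of `LevelSepPP … 1` FAILS at truncation `m = 2` — and
`0 ∈ Λs 2 0` with `L⁰•0 = 0 ∈ Ω₁` is NOT a point of `Λ_0 = Ω₀^{(0)} ∖ Ω₁^{(0)}`, so the (1.5)-reading FAILS too.  Only print's (1.5) («Λ_j = Ω_j^{(j)} ∖ Ω_{j+1}^{(j)}», which
the index does NOT type) forbids such tops.  CONSEQUENCE (census, for the planners ∕ the records' lineage ∕ the binder owner — nothing ruled here): the (1.5)-reading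
displayed in p609116 ∕ p611723 is NOT dischargeable on `IdxB8SubC θ`; a socket keyed «`∀ i, i.Ω 0 = univ → IdxB8LawsB θ.L i → DomainSeq θ.L i.Ω → …`» cannot be
supplied THROUGH `hlaw` at every such member; either the clause rides with the member (as now) or the index gains a third conjunct — exactly the situation of this
seat's g2 certificate `B8IdxB8SubBCollarVacuity` for (1.4), which the «P₂C» re-index resolved by conjoining `DomainSeq`.  (Cell bus 2026-08-28 07:24Z, dag-n05-c
DESIGN WORD, concurrent and independent: the same (1.5) reading — `LamTop`, this lineage's `hΛ` text — is proposed as the repair letter for dag-n05-w1's located `SLet`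
defect at the all-`univ` member `i⋆`; the present witness is a DIFFERENT member and a different defect — the class law — so the two certificates complement each other.)

## WHAT IS PROVED (kernel, 0 sorry; theorems only)

* §1 member-free negatives: ★ `not_levelSepPP_towerBondsP_of_extraTops` (`L ≥ 1`, `Ω 0 = univ`, `2 ≤ m`, `z₀, z₀ + e_μ ∈ Λs m 0`, `z₀ ∈ Ω 2` ⇒
  `¬ LevelSepPP L m Ω (fun m' j => towerBondsP L Ω (Λs m') j) 1`), `not_lamTop_of_extraTop` (`k ≥ 1`, `z₀ ∈ Λs k 0`, `z₀ ∈ Ω 1` ⇒ the top family does NOT read (1.5)).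
* §2 the witness: `zero_mem_cube_two_two` (`0 ∈ □₂` of the tower `(ℤᵈ, □₁, □₂)` at `a = 0, M = 1, ρ = L`), ★ `exists_member_extraTops` (`d`-general: a `ZdIdx d L` member
  with `k = 2`, `Ω = cubeFam true L 0 1 L 2`, `0, e_μ ∈ Λs 2 0`, `Λb = towerBonds`, `IdxB8LawsB` — built on `exists_topCube_member_pinned`, all laws re-verified),
  ★ `exists_idxB8SubC_extraTops` (the same as a term of `IdxB8SubC θ`, every `θ`, every axis `μ : Fin θ.D`).
* §3 ★★ `exists_idxB8SubC_not_levelSepPP_towerBondsP` · ★★ `not_forall_idxB8SubC_levelSepPP_towerBondsP` (the P-class law at print's class is NOT a law of the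
  «P₂C» index) · ★ `exists_idxB8SubC_not_lamTop` · ★ `not_forall_idxB8SubC_lamTop` (nor is the (1.5)-reading).

## HONEST SCOPE

A VACUITY ∕ NECESSITY certificate about TYPED INDEX LAWS — lattice bookkeeping on `ℤᵈ`; nothing of [Balaban1985RegularSpaces] ∕ [4] is asserted or denied: print's own
families read (1.5) by definition (`B8TowerBondsLayerLawSubC` §2), so NOTHING of Bałaban's is refuted; whether dag-n06-b's `AvgAtP ∕ AvgAtγ` bounds or the b9 sockets
THEMSELVES fail at the extra-top member is NOT claimed (only that the `hlaw` ROUTE to them is closed there).  Count-neutral; N05 ∕ N06 NOT discharged; no count claim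
(the chair's single count line is the only count); `T_η ↦ ℤᵈ`; one finite `𝕋⁴` programme at fixed `ε`, Bałaban AS PRINTED; the Yang–Mills mass gap (Clay) is NOT proved
by any of this — R4 closes the conditional finite-`𝕋⁴` rung `BalabanLadder.UV` only; nothing continuum ∕ ℝ⁴ ∕ OS.  No `sorry`, no `def`, no `instance`, no `notation`.
Unit `pub-ymgap-dag-n05-w2` (g3), 2026-08-28.

RELATED IN THE TREE, NOT DUPLICATED: `B8TowerBondsLayerLawSubC` (this seat g3: the pinned tower, the faces on `IdxB8SubC` — USED), `B8TowerBondsLayerLawOfLam` (n05-w6 g2),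
`B8TowerBondsLevelSep` (this seat g2: the class-law lemma), `B8IdxB8SubBCollarVacuity` (this seat g2: the (1.4) analogue on `IdxB8SubB`), `B8IdxB8LawsB` ∕ `B8TowerBondsNonempty`
(n05-c: `towerBonds`, the laws BITE on empty-bond members — a different defect), `Node00/CarriersB8SubBP2C` (n05-w1: `IdxB8SubC`), `B8TowerBondsPrinted` (D0: `towerBondsP`,
`inner_mem_towerBondsP`, USED), `B8Eq131Cubes` ∕ `B8Eq131CubesAdmissible` ∕ `B8CubeMemberZd` (the cube geometry, USED).

[cite: Balaban1985RegularSpaces, (1.3)–(1.6) p.77, (1.19) p.79, (1.31) p.82, (1.34) p.82, (1.131) p.99, p.98; Balaban1984PropagatorsII, (2.1)–(2.3) p.224;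
Balaban1985BackgroundPropagators, (3.16) p.393]
-/

noncomputable section

namespace Literature.MathematicalPhysics.QuantumFieldTheory.Balaban1983to89.B8IdxB8SubCLayerLawVacuity

open B7Prop1Explicit B7Prop1Local
open B8Ineq132 (Under BondTouches)
open B8LeafModelZd (ZdIdx)
open B8ConstraintBonds (DomainSeq Lam)
open B8Ineq130 (tlo thi)
open B8Eq131Cubes (cube sqLo sqHi bLo bHi gs_zero)
open B8Eq131CubesAdmissible (cubeFam cubeFam_true_zero cubeFam_of_pos cubeFam_domainSeq smul_mem_cube_iff)
open B8CubeMemberZd (cubeLamS smul_mem_bondBox)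
open B8TowerBondsPrinted (towerBondsP inner_mem_towerBondsP)
open B9Eq316AveragingTransposeZdPrinted (LevelSepPP)
open B8IdxB8LawsB (towerBonds towerBonds_hbox towerBonds_hclass IdxB8LawsB IdxB8SubB)
open B8TowerBondsLayerLawSubC (exists_topCube_member_pinned)
open Node00 (Stage3Params IdxB8SubC)

-- `Site` alone could resolve to the torus sites of `Setup.lean`; re-export the `ℤ^d` sites of `B7Prop1Explicit`.
export B7Prop1Explicit (Site)

/-- `1 ≤ θ.L` (Bałaban's block size is odd `> 1`; private plumbing). [folklore] -/
private theorem one_le_L (θ : Stage3Params) : 1 ≤ θ.L := le_trans (by norm_num) θ.two_le_L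

/-- An axis `μ : Fin θ.D` exists (`θ.D = d₆ + 1 ≥ 1`; private plumbing). [folklore] -/
private theorem dim_pos (θ : Stage3Params) : 0 < θ.D := by
  rw [← θ.hd₆]; exact Nat.succ_pos _

variable {d : ℕ}

/-! ## §1 Member-free negatives: two extra level-`0` tops inside `Ω₂` break the class law and the (1.5)-reading -/

section Negative

variable {L : ℕ}

/-- ★ **TWO ADJACENT LEVEL-`0` TOPS INSIDE `Ω₂` BREAK THE P-CLASS LAW** (`L ≥ 1`, `Ω₀ = ℤᵈ`, truncation `m ≥ 2`): if `z₀` and `z₀ + e_μ` are both level-`0` tops of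
`Λs m` and `z₀ ∈ Ω₂`, then `LevelSepPP L m Ω (fun m' j => towerBondsP L Ω (Λs m') j) 1` FAILS — `⟨z₀, z₀ + e_μ⟩` is an INNER level-`0` bond of print's class (1.31)
(box in `Ω₀ = ℤᵈ`), its box site `z₀` carries a unit bond touching `Ω₂`, and clause 2 would give `2 ≤ 0 + 1`.
[cite: Balaban1985RegularSpaces, (1.31) p.82 («⟨x, x′⟩ ⊂ Λ_j»), (1.3)–(1.5) p.77; Balaban1984PropagatorsII, (2.1)–(2.3) p.224; Balaban1985BackgroundPropagators, (3.16) p.393] -/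
theorem not_levelSepPP_towerBondsP_of_extraTops (hL : 1 ≤ L) {Ω : ℕ → Set (Site d)} (hΩ0 : Ω 0 = Set.univ)
    {Λs : ℕ → ℕ → Set (Site d)} {m : ℕ} (hm : 2 ≤ m) {z₀ : Site d} {μ : Fin d}
    (h₁ : z₀ ∈ Λs m 0) (h₂ : z₀ + e μ ∈ Λs m 0) (hz : z₀ ∈ Ω 2) :
    ¬ LevelSepPP L m Ω (fun m' j => towerBondsP L Ω (Λs m') j) 1 := by
  intro H
  have hc : ((z₀, μ) : Site d × Fin d) ∈ towerBondsP L Ω (Λs m) 0 :=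
    inner_mem_towerBondsP L (fun x _ => by rw [hΩ0]; exact Set.mem_univ x) h₁ h₂
  have hbox : InBox (loK L 0 z₀) (bondHiK L 0 z₀ μ) z₀ := by
    have h := smul_mem_bondBox hL 0 z₀ μ
    rwa [pow_zero, one_smul] at h
  obtain ⟨-, h2⟩ := H 0 (Nat.zero_le m) (z₀, μ) hc z₀ hbox
  have h21 : 2 ≤ 0 + 1 := h2 2 hm μ (Or.inl hz)
  omega

/-- **AN EXTRA LEVEL-`0` TOP INSIDE `Ω₁` BREAKS THE (1.5)-READING** (`k ≥ 1`): if `z₀ ∈ Λs k 0` lies in `Ω₁` then `L⁰•z₀ = z₀ ∉ Λ_0 = Ω₀^{(0)} ∖ Ω₁^{(0)}`, so the top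
family does NOT read print's (1.5) below the top. [cite: Balaban1985RegularSpaces, (1.5) p.77 («Λ_j = Ω_j^{(j)} ∖ Ω_{j+1}^{(j)}»)] -/
theorem not_lamTop_of_extraTop {Ω : ℕ → Set (Site d)} {Λs : ℕ → ℕ → Set (Site d)} {k : ℕ} (hk : 1 ≤ k) {z₀ : Site d}
    (h : z₀ ∈ Λs k 0) (hz1 : z₀ ∈ Ω 1) :
    ¬ (∀ j, j < k → ∀ z ∈ Λs k j, ((L : ℤ) ^ j) • z ∈ Lam L Ω j) := by
  intro H
  have h0 := H 0 hk z₀ h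
  rw [pow_zero, one_smul] at h0
  exact h0.2.2 hz1

end Negative

/-! ## §2 The witness: print's tower `(ℤᵈ, □₁, □₂)` with two extra level-`0` tops `0, e_μ ∈ □₂`, lawful and admissible -/

section Witness

variable {L : ℕ}

/-- `0 ∈ □₂` for the tower `(ℤᵈ, □₁, □₂)` at `a = 0`, `M = 1`, `ρ = L`, `k = 2` (`L ≥ 1`): `□₂ = L²·[−L, L]ᵈ ∋ 0` (`B8Eq131CubesAdmissible.smul_mem_cube_iff` at `y = 0`).
[cite: Balaban1985RegularSpaces, (1.131) p.99, p.98] -/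
theorem zero_mem_cube_two_two (hL : 1 ≤ L) : (0 : Site d) ∈ cube L (0 : Site d) 1 L 2 2 := by
  have h := (smul_mem_cube_iff hL (0 : Site d) 1 L 2 2 (0 : Site d)).mpr (fun i => by
    simp only [sqLo, sqHi, bLo, bHi, Nat.sub_self, gs_zero, pow_zero, one_mul, mul_one, Pi.zero_apply]
    constructor <;> push_cast <;> omega)
  rwa [smul_zero] at h

/-- ★ **THE EXTRA-TOP MEMBER** (`d`-general; `L ≥ 1`, `0 < η`, `L²η ≤ 1`, an axis `μ`): a member `i : ZdIdx d L` with `k = 2`, `Ω = (ℤᵈ, □₁, □₂)` (`cubeFam true L 0 1 L 2`),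
`Λb = towerBonds` and the four located laws `IdxB8LawsB`, whose TOP level-`0` family contains the two ADJACENT sites `0` and `e_μ` of `□₂` — print's pinned tower
(`B8TowerBondsLayerLawSubC.exists_topCube_member_pinned`) with `{0, e_μ}` adjoined to `Λs m 0` at every truncation `m ≥ 1`; every typed law is re-verified from the pinned
member's (extra tops are tolerated by `htower` — `0`-blocks are points of `Ω₀ = ℤᵈ` —, by `hpart ∕ cover` — more tops —, by `trunc_lt` — the same tops at every `m ≥ 1` —,
by `trunc_top` — `Λs 0 0 = ℤᵈ` —, and by `hbox ∕ hclass ∕ bonds` — the classes are `towerBonds` of the new family).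
[cite: Balaban1985RegularSpaces, (1.3)–(1.6) p.77, (1.19) p.79, (1.34) p.82, (1.131) p.99, p.98] -/
theorem exists_member_extraTops (hL : 1 ≤ L) {η : ℝ} (hη : 0 < η) (hscale : (L : ℝ) ^ 2 * η ≤ 1) (μ : Fin d) :
    ∃ i : ZdIdx d L, i.k = 2 ∧ i.η = η ∧ i.Ω = cubeFam true L (0 : Site d) 1 L 2 ∧ (0 : Site d) ∈ i.Λs 2 0 ∧ e μ ∈ i.Λs 2 0 ∧
      (∀ m j, i.Λb m j = towerBonds L i.Ω (i.Λs m) j) ∧ IdxB8LawsB L i := by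
  classical
  obtain ⟨i, hik, hiη, hΩ, hΛ, -, hlaws⟩ := exists_topCube_member_pinned (d := d) hL (0 : Site d) 1 (le_refl L) (by norm_num : 1 ≤ 2) hη hscale
  have hΩ0 : i.Ω 0 = Set.univ := by rw [hΩ]; exact cubeFam_true_zero L 0 1 L 2
  have hΛ00 : i.Λs 0 0 = Set.univ := by rw [hΛ]; simp
  -- the extra tops
  let S : Set (Site d) := {z | z = 0 ∨ z = e μ}
  let ΛE : ℕ → ℕ → Set (Site d) := fun m j => if j = 0 ∧ 1 ≤ m then i.Λs m 0 ∪ S else i.Λs m j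
  have hE0 : ∀ m, 1 ≤ m → ΛE m 0 = i.Λs m 0 ∪ S := fun m hm => by
    simp only [ΛE, if_pos (And.intro rfl hm)]
  have hE00 : ΛE 0 0 = i.Λs 0 0 := by
    simp only [ΛE]
    rw [if_neg (by omega)]
  have hEpos : ∀ m j, 1 ≤ j → ΛE m j = i.Λs m j := fun m j hj => by
    simp only [ΛE]
    rw [if_neg (by omega)]
  have hsub : ∀ m j, i.Λs m j ⊆ ΛE m j := by
    intro m j z hz
    rcases Nat.eq_zero_or_pos j with rfl | hj
    · rcases Nat.eq_zero_or_pos m with rfl | hm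
      · rw [hE00]; exact hz
      · rw [hE0 m hm]; exact Set.mem_union_left _ hz
    · rw [hEpos m j hj]; exact hz
  refine ⟨⟨i.η, i.hη, i.k, i.hk, i.Ω, i.hΩ, ΛE, fun m j => towerBonds L i.Ω (ΛE m) j,
    towerBonds_hbox L i.Ω ΛE i.k, towerBonds_hclass L i.Ω ΛE i.k, ?_, ?_⟩, hik, hiη, hΩ, ?_, ?_, fun _ _ => rfl, ?_⟩
  · -- htower
    intro j hj y hy x hx
    rcases Nat.eq_zero_or_pos j with rfl | hjpos
    · rw [hΩ0]; exact Set.mem_univ x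
    · rw [hEpos i.k j hjpos] at hy
      exact i.htower j hj y hy x hx
  · -- hpart
    intro x hx
    obtain ⟨j, hj, y, hy, hB⟩ := i.hpart x hx
    exact ⟨j, hj, y, hsub i.k j hy, hB⟩
  · -- `0 ∈ Λs 2 0`
    show (0 : Site d) ∈ ΛE 2 0
    rw [hE0 2 (by norm_num)]; exact Set.mem_union_right _ (Or.inl rfl)
  · -- `e_μ ∈ Λs 2 0`
    show e μ ∈ ΛE 2 0
    rw [hE0 2 (by norm_num)]; exact Set.mem_union_right _ (Or.inr rfl)
  · -- the located laws
    refine ⟨⟨hlaws.scale, ?_, ?_, ?_⟩, fun _ _ => rfl⟩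
    · -- №8 below the top
      intro m hm j hj
      show ΛE m j = ΛE (m + 1) j
      rcases Nat.eq_zero_or_pos j with rfl | hjpos
      · rw [hE0 m (by omega), hE0 (m + 1) (by omega), hlaws.trunc_lt m hm 0 hj]
      · rw [hEpos m j hjpos, hEpos (m + 1) j hjpos]
        exact hlaws.trunc_lt m hm j hj
    · -- №8 at the top
      intro m hm x
      show x ∈ ΛE m m ↔ x ∈ ΛE (m + 1) m ∨ ∃ y ∈ ΛE (m + 1) (m + 1), x ∈ Literature.MathematicalPhysics.QuantumLattice.blockSites L y
      rcases Nat.eq_zero_or_pos m with rfl | hmpos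
      · rw [hE00, hΛ00, hE0 1 le_rfl, hEpos 1 1 le_rfl]
        refine ⟨fun _ => ?_, fun _ => Set.mem_univ x⟩
        have h := (hlaws.trunc_top 0 hm x).mp (by rw [hΛ00]; exact Set.mem_univ x)
        rcases h with h | h
        · exact Or.inl (Set.mem_union_left _ h)
        · exact Or.inr h
      · rw [hEpos m m hmpos, hEpos (m + 1) m hmpos, hEpos (m + 1) (m + 1) (by omega)]
        exact hlaws.trunc_top m hm x
    · -- №11 (1.6) at every level
      intro ℓ hℓ w hw
      obtain ⟨j, h1, h2, y, hy, hU⟩ := hlaws.cover ℓ hℓ w hw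
      exact ⟨j, h1, h2, y, hsub i.k j hy, hU⟩

/-- ★ **THE EXTRA-TOP MEMBER IS A TERM OF THE ADMISSIBLE SUB-INDEX OF RECORD** (every `θ`, every axis `μ : Fin θ.D`): with `η = L⁻²` it obeys №7 with equality, its
`Ω = (ℤᵈ, □₁, □₂)` is a (1.3)–(1.4) domain sequence (`cubeFam_domainSeq true`, `ρ = L`) with `Ω₀ = ℤᵈ` — so `j : IdxB8SubC θ` with `j.k = 2`, `0, e_μ ∈ j.Λs 2 0`, `0 ∈ j.Ω 2`.
[cite: Balaban1985RegularSpaces, (1.3)–(1.6) p.77, (1.131) p.99, p.98] -/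
theorem exists_idxB8SubC_extraTops (θ : Stage3Params) (μ : Fin θ.D) :
    ∃ j : IdxB8SubC θ, j.1.1.1.k = 2 ∧ j.1.1.1.Ω = cubeFam true θ.L (0 : Site θ.D) 1 θ.L 2 ∧
      (0 : Site θ.D) ∈ j.1.1.1.Λs 2 0 ∧ e μ ∈ j.1.1.1.Λs 2 0 ∧ (0 : Site θ.D) ∈ j.1.1.1.Ω 2 := by
  have hL : 1 ≤ θ.L := one_le_L θ
  have hL0 : (0 : ℝ) < θ.L := by exact_mod_cast (show 0 < θ.L by omega)
  have hη : (0 : ℝ) < ((θ.L : ℝ)⁻¹) ^ 2 := pow_pos (inv_pos.mpr hL0) 2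
  have hscale : (θ.L : ℝ) ^ 2 * ((θ.L : ℝ)⁻¹) ^ 2 ≤ 1 := by
    rw [← mul_pow, mul_inv_cancel₀ hL0.ne', one_pow]
  obtain ⟨i, hik, -, hΩ, h0, he, -, hlaws⟩ := exists_member_extraTops (d := θ.D) hL hη hscale μ
  have hΩ0 : i.Ω 0 = Set.univ := by rw [hΩ]; exact cubeFam_true_zero θ.L 0 1 θ.L 2
  have hds : DomainSeq θ.L i.Ω := by rw [hΩ]; exact cubeFam_domainSeq true hL 0 1 (le_refl θ.L) 2
  refine ⟨(⟨⟨⟨i, hΩ0⟩, hlaws⟩, hds⟩ : {j : IdxB8SubB θ // DomainSeq θ.L j.1.1.Ω}), hik, hΩ, ?_, ?_, ?_⟩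
  · show (0 : Site θ.D) ∈ i.Λs 2 0
    exact h0
  · show e μ ∈ i.Λs 2 0
    exact he
  · show (0 : Site θ.D) ∈ i.Ω 2
    rw [hΩ, cubeFam_of_pos true θ.L 0 1 θ.L (by norm_num : 1 ≤ 2) (le_refl 2)]
    exact zero_mem_cube_two_two hL

end Witness

/-! ## §3 The P-class law and the (1.5)-reading are NOT laws of the «P₂C» index -/

section NotALaw

/-- ★★ **A MEMBER OF THE «P₂C» INDEX AT WHICH THE P-CLASS LAW FAILS** (every `θ`): the extra-top member (depth `2`) violates
`LevelSepPP θ.L 2 j.Ω (fun m l => towerBondsP θ.L j.Ω (j.Λs m) l) 1` — the `hlaw` of `B8TowerBondsLevelSep` ∕ dag-n06-b's binders at print's class, at the top truncation.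
[cite: Balaban1985RegularSpaces, (1.31) p.82, (1.3)–(1.6) p.77; Balaban1984PropagatorsII, (2.1)–(2.3) p.224; Balaban1985BackgroundPropagators, (3.16) p.393] -/
theorem exists_idxB8SubC_not_levelSepPP_towerBondsP (θ : Stage3Params) :
    ∃ j : IdxB8SubC θ, j.1.1.1.k = 2 ∧
      ¬ LevelSepPP θ.L 2 j.1.1.1.Ω (fun m l => towerBondsP θ.L j.1.1.1.Ω (j.1.1.1.Λs m) l) 1 := by
  obtain ⟨j, hk, -, h0, he, hz⟩ := exists_idxB8SubC_extraTops θ ⟨0, dim_pos θ⟩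
  refine ⟨j, hk, ?_⟩
  have he' : (0 : Site θ.D) + e (⟨0, dim_pos θ⟩ : Fin θ.D) ∈ j.1.1.1.Λs 2 0 := by rw [zero_add]; exact he
  exact not_levelSepPP_towerBondsP_of_extraTops (one_le_L θ) j.1.1.2 le_rfl h0 he' hz

/-- ★★ **THE P-CLASS LAW IS NOT A LAW OF THE ADMISSIBLE SUB-INDEX OF RECORD**: it is FALSE that every `j : IdxB8SubC θ` satisfies
`LevelSepPP θ.L m j.Ω (fun m' l => towerBondsP θ.L j.Ω (j.Λs m') l) 1` at every truncation `m ≤ j.k` — so the (1.5)-reading clause of `B8TowerBondsLayerLawOfLam` ∕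
`B8TowerBondsLayerLawSubC` (under which it holds) is a genuine member hypothesis, not derivable from the index's typed laws (census exhibit; nothing of print's refuted).
[cite: Balaban1985RegularSpaces, (1.31) p.82, (1.3)–(1.6) p.77; Balaban1984PropagatorsII, (2.1)–(2.3) p.224] -/
theorem not_forall_idxB8SubC_levelSepPP_towerBondsP (θ : Stage3Params) :
    ¬ ∀ j : IdxB8SubC θ, ∀ m, m ≤ j.1.1.1.k →
        LevelSepPP θ.L m j.1.1.1.Ω (fun m' l => towerBondsP θ.L j.1.1.1.Ω (j.1.1.1.Λs m') l) 1 := by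
  intro H
  obtain ⟨j, hk, hneg⟩ := exists_idxB8SubC_not_levelSepPP_towerBondsP θ
  exact hneg (H j 2 (by rw [hk]))

/-- ★ **A MEMBER OF THE «P₂C» INDEX WHOSE TOP FAMILY DOES NOT READ (1.5)** (every `θ`): at the extra-top member, `0 ∈ Λs 2 0` but `L⁰•0 = 0 ∈ Ω₁ = □₁ ⊇ □₂`.
[cite: Balaban1985RegularSpaces, (1.5) p.77, (1.131) p.99] -/
theorem exists_idxB8SubC_not_lamTop (θ : Stage3Params) :
    ∃ j : IdxB8SubC θ, j.1.1.1.k = 2 ∧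
      ¬ (∀ l, l < j.1.1.1.k → ∀ z ∈ j.1.1.1.Λs j.1.1.1.k l, ((θ.L : ℤ) ^ l) • z ∈ Lam θ.L j.1.1.1.Ω l) := by
  obtain ⟨j, hk, -, h0, -, hz⟩ := exists_idxB8SubC_extraTops θ ⟨0, dim_pos θ⟩
  refine ⟨j, hk, ?_⟩
  rw [hk]
  exact not_lamTop_of_extraTop (by norm_num : 1 ≤ 2) h0 (j.1.1.1.hΩ 1 hz)

/-- ★ **THE (1.5)-READING IS NOT A LAW OF THE ADMISSIBLE SUB-INDEX OF RECORD**: it is FALSE that every `j : IdxB8SubC θ` has its top restriction family reading print's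
territories below the top — the one displayed clause of `B8TowerBondsLayerLawSubC` §1 is NOT dischargeable from `IdxB8SubC θ`'s typed laws (`ZdIdx` laws, №7 ∕ №8 ∕ №11 ∕ №12,
`DomainSeq`, `Ω₀ = ℤᵈ`): only (1.5) itself, which the index does not type, excludes extra tops. [cite: Balaban1985RegularSpaces, (1.5) p.77, (1.3)–(1.6) p.77, (1.131) p.99] -/
theorem not_forall_idxB8SubC_lamTop (θ : Stage3Params) :
    ¬ ∀ j : IdxB8SubC θ, ∀ l, l < j.1.1.1.k → ∀ z ∈ j.1.1.1.Λs j.1.1.1.k l, ((θ.L : ℤ) ^ l) • z ∈ Lam θ.L j.1.1.1.Ω l := by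
  intro H
  obtain ⟨j, -, hneg⟩ := exists_idxB8SubC_not_lamTop θ
  exact hneg (H j)

end NotALaw

end Literature.MathematicalPhysics.QuantumFieldTheory.Balaban1983to89.B8IdxB8SubCLayerLawVacuity

end
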